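import Summits.ResolutionOfSingularities.ResolutionOfSingularities.Theorems.FrobeniusClosingPatchingRelPerfectMonomialRouteKStepIdeal
import Summits.ResolutionOfSingularities.ResolutionOfSingularities.Theorems.FrobeniusClosingPatchingRelPerfectMonomialRouteKStepSym
import Summits.ResolutionOfSingularities.ResolutionOfSingularities.Theorems.FrobeniusClosingPatchingRelPerfectMonomialRouteKLevelZero
import Summits.ResolutionOfSingularities.ResolutionOfSingularities.Theorems.FrobeniusClosingPatchingRelPerfectMonomialPolyhedraGameReduction
import HarnessLib

/-!
# Crux `PatchingRelPerfect` (stmt-ResolutionOfSingularities-16161), chain w52 — TargetsF3 (m)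
# «M2-strong», COMBINATORIAL HALF, Route K steps K16 + K18: THE STEP, THE INDUCTION, THE WIN —
# `RouteKTarget m` HOLDS FOR EVERY MARKING `m ≥ 1`

[OURS · L1 W5.2 · design memo v3 (`L/res-type-075/M2STRONG-COMBINATORIAL-HALF.md`); fact-free (kernel
axioms only: the external inputs are the tree's PROVED Kollár theorems 3.103/3.107, functorial order reduction
for marked ideals in characteristic zero, consumed at level zero in file K17); nothing here is a statement of the
manuscript under review]

* **`Good.step`**: if `Good L m s Y D M (C :: rest) 𝒞` (file K9) and `mv` is a block play of the components of
  the head centre `C` (files K9/K10), then `Good L m (s.moves m mv) (Bl_C Y) newD (M.transform π C) rest newCharts`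
  (files K13a–K15): the remaining functorial sequence is shorter by one.
* **`Good.winnableAll`**: induction on the length of the remaining functorial sequence (one BLOCK of game moves
  per Kollár blow-up, file K10; an exhausted sequence is a win, `Good.wonM_of_nil`).
* **`routeKTarget : 1 ≤ m → RouteKTarget m`** — HIRONAKA'S POLYHEDRA GAME WITH MULTIPLICITY `m` IS WINNABLE WITH
  PERMISSIBLE CENTRES, ALL NAMES AT ONCE: every well-formed state (a finite set `A` of exponent vectors on a
  stratum complex) is brought, by blowing up strata on which every generator has weight `≥ m`, to a state in
  which on every stratum some generator has weight `< m` (`PolyhedraGame.RouteKTarget`, p511685) — by the simplex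
  reduction (file K6), level zero (file K17: the toric model `Spec ℚ[x_B]` and the tree's functorial sequence)
  and the induction above.  For `m = 1` it yields the M2-strong target `GlobalPermissiblePolyhedraGame` by
  `globalPermissiblePolyhedraGame_of_routeKTarget` (p511685) — a second, independent route; the tree's proof of
  record is Route F's characteristic-free `globalPermissiblePolyhedraGame_holds` (res-L1-w52-stub-4), which is why
  the corollary is not restated here; for `m ≥ 2` (order reduction of MARKED sums of monomials) it is new in the
  tree.

## References

* J. Kollár, *Lectures on Resolution of Singularities* (2007), Thms. 3.103, 3.107, (3.111) Step 3. [Kollar2007]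
* H. Hironaka, *Resolution of singularities of an algebraic variety over a field of characteristic zero*,
  Ann. of Math. 79 (1964) (the polyhedra game). [Hironaka1964]
* M. Spivakovsky, *A solution to Hironaka's polyhedra game* (1983). [Spivakovsky1983]
-/

-- `Summit.<Summit>.<Sub>.Theorems` with `Sub = Summit` (single-conjunct summit, D-0017)
set_option linter.dupNamespace false

noncomputable section

open CategoryTheory AlgebraicGeometry TopologicalSpace
open Literature.AlgebraicGeometry.Resolution

namespace Summit.ResolutionOfSingularities.ResolutionOfSingularities.Theorems

namespace PolyhedraGame

namespace RouteK

variable {L : Finset ℕ} {m : ℕ} {s : State} {Y : Scheme.{0}} {D : ℕ → Y.IdealSheafData} {M : MarkedIdeal Y}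
  {C : Y.IdealSheafData} {rest : CentreSeq (blowup C)} {𝒞 : Set (Chart L Y)}

/-- [OURS · W5.2 M2-strong · Route K, K16] **The step of the tower**: after a block play of the components
of the head centre, the blow-up `Bl_C Y` with the new boundary, Kollár's transformed marked ideal, the TAIL
of the functorial sequence and the new toric atlas again satisfy the invariant. -/
theorem Good.step (G : Good L m s Y D M (CentreSeq.cons C rest) 𝒞) (hm : 1 ≤ m) (hs : s.WF)
    {mv : List (Finset ℕ × ℕ)} (hmv : BlockPlay m s G.components mv) :
    Good L m (s.moves m mv) (blowup C) (newD s D C mv) (M.transform (blowup.π C) C) rest (newCharts 𝒞 C mv) where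
  locNoeth := by haveI := G.locNoeth; exact CentreSeq.isLocallyNoetherian_blowup C
  mult := by rw [MarkedIdeal.transform_mult, G.mult]
  res := ⟨((CentreSeq.isAdmissibleFor_cons C rest M).mp G.res.1).2.2.2, G.res.2⟩
  noEmpty := ((CentreSeq.noEmptyCentres_cons C rest).mp G.noEmpty).2
  D_top l hl := G.newD_top hm hs hmv hl
  lab_inj c' hc' := G.newCharts_lab_inj hm hs hmv hc'
  cone_mem c' hc' := G.newCharts_cone_mem hm hs hmv hc'
  cov_str T hT := G.newCharts_cov_str hm hs hmv hT
  cov_pts y' := G.newCharts_cov_pts hm hs hmv y'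
  img_D c' hc' b := G.img_newD hm hs hmv hc' b
  img_D_top c' hc' l hl := G.img_newD_top hm hs hmv hc' hl
  img_M c' hc' := G.img_newM hm hs hmv hc'
  mem_U_iff c' hc' y' := G.newCharts_mem_U_iff hm hs hmv hc' y'
  sym c' hc' t ht := G.newCharts_sym hm hs hmv hc' t ht

/-! ## The induction along the tower -/

/-- [OURS · W5.2 M2-strong · Route K] **An exhausted sequence is a local win** (`supp (M, m) = ∅`). -/
theorem Good.wonM_of_nil {𝒞 : Set (Chart L Y)} (G : Good L m s Y D M (CentreSeq.nil Y) 𝒞) :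
    WonM m s := by
  intro T hT
  obtain ⟨c, hc, hTc⟩ := G.cov_str T hT
  -- the variables labelled in `T`
  set S : Finset L := Finset.univ.filter fun b => c.lab b ∈ T with hSdef
  have hlab : c.labels S = T := by
    ext l
    constructor
    · intro hl
      obtain ⟨b, hb, rfl⟩ := Finset.mem_image.mp hl
      exact (Finset.mem_filter.mp hb).2
    · intro hl
      obtain ⟨b, hbL, rfl⟩ := Finset.mem_image.mp (hTc hl)
      exact Finset.mem_image.mpr ⟨⟨b, hbL⟩, Finset.mem_filter.mpr ⟨Finset.mem_univ _, hl⟩, rfl⟩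
  haveI := coordIdeal_isPrime (K := ℚ) S
  have hsupp : M.support = ∅ := G.res.2
  have hy : c.point (coordIdeal (K := ℚ) S) ∉ M.support := by rw [hsupp]; exact fun h => h
  have hM : M = ⟨M.ideal, M.boundary, M.mult⟩ := rfl
  rw [hM, G.mult, c.point_coordIdeal_mem_markedSupport_iff S s.A M.ideal (G.img_M c hc) M.boundary m] at hy
  push Not at hy
  obtain ⟨α, hα, hlt⟩ := hy
  refine ⟨α, hα, ?_⟩
  rwa [← hlab, c.weight_labels (G.lab_inj c hc)]

/-- [OURS · W5.2 M2-strong · Route K] **The invariant at any level gives an all-names win**: induction on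
the length of the remaining functorial sequence, one BLOCK (file K10) per blow-up (file K16). -/
theorem Good.winnableAll (hm : 1 ≤ m) : ∀ (n : ℕ) {s : State} {Y : Scheme.{0}}
    {D : ℕ → Y.IdealSheafData} {M : MarkedIdeal Y} {𝔱 : CentreSeq Y} {𝒞 : Set (Chart L Y)},
    s.WF → Good L m s Y D M 𝔱 𝒞 → 𝔱.length = n → WinnableAll m s := by
  intro n
  induction n with
  | zero =>
    intro s Y D M 𝔱 𝒞 hs G hlen
    cases 𝔱 with
    | nil _ => exact WinnableAll.done G.wonM_of_nil
    | cons C rest => simp [CentreSeq.length] at hlen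
  | succ n ih =>
    intro s Y D M 𝔱 𝒞 hs G hlen
    cases 𝔱 with
    | nil _ => simp [CentreSeq.length] at hlen
    | cons C rest =>
      have hlen' : rest.length = n := by simp [CentreSeq.length] at hlen; exact hlen
      exact winnableAll_of_block G.components.card rfl hs (G.components_nonempty hm hs)
        (G.disjointFamily_components hm hs) fun mv hmv => ih (WF.moves hs mv) (G.step hm hs hmv) hlen'

end RouteK

/-! ## The win -/

/-- [OURS · W5.2 M2-strong · Route K, K18] **Hironaka's polyhedra game with multiplicity `m ≥ 1` is winnable with
permissible centres, all names at once** (`RouteKTarget m`): reduce to simplex states (file K6), realise the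
state torically on `Spec ℚ[x_B]` with the tree's functorial order-reduction sequence (file K17, level zero of the
invariant `Good`), and climb the tower (`Good.winnableAll`). -/
theorem routeKTarget {m : ℕ} (hm : 1 ≤ m) : RouteKTarget m :=
  routeKTarget_of_simplex fun s hs hstr => by
    obtain ⟨𝔱, G⟩ := RouteK.good_levelZero hs hstr hm
    exact RouteK.Good.winnableAll hm 𝔱.length hs G rfl

end PolyhedraGame

end Summit.ResolutionOfSingularities.ResolutionOfSingularities.Theorems

end
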